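import Mathlib
import Summits.MatrixMultiplication.MatrixMultiplication.Theorems.SnSubsetDichotomyNoThresholdSubsetTripleShapeBeforeDefs
import Summits.MatrixMultiplication.MatrixMultiplication.Theorems.SnSubsetDichotomyNoThresholdSubsetTripleCardTableauPair

/-!
# Definitions: the Plancherel growth as a probability space with a filtration (route `SnSubsetDichotomy`, crux `NoThresholdSubsetTriple`)

Objects of the MODEL theorem of the klr line's (Q)-programme (lead c7 report
`Cruxes/NoThresholdSubsetTriple/Lines/klr_graded_polynomial_method-lead-c7.md` §2a/§4, crux workfile `Lines/klr_dev_rungs2.lean`):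
the uniform probability measure on the same-shape tableau pairs `TableauPair n` (so that `μ.real E = #E / n!`, which is how the route's
counting statements `Nat.card {…} ≤ n!·bound` are read), and the PREFIX FILTRATION `ℱ_t` generated by the cells of the entries `< t` of
the second tableau — the natural filtration of the growth `ν_t = PlancherelStep.shapeBefore T t`.  The combinatorial core (the
`ℱ_t`-blocks have `t!·#block = n!·f^{ν_t}`, `prefix_block_card`) and the hook ratio (`transProb_mul_card_stdFilling`) make the
conditional law of `ν_{t+1}` given `ℱ_t` the Plancherel kernel `PlancherelStep.transProb` (proved separately).

* `PlancherelGrowth.instMeasurableSpace` — the discrete σ-algebra `⊤` on `TableauPair n`;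
* `PlancherelGrowth.pairMeasure n = (n!)⁻¹ • count` — the uniform probability measure;
* `PlancherelGrowth.prefixKey n t ω : Fin n → Option (ℕ × ℕ)` — the cells of the entries `< t` of the second tableau (`none` beyond);
* `PlancherelGrowth.prefixFiltration n : Filtration ℕ ⊤` — `ℱ_t = comap (prefixKey n t) ⊤`.
-/

noncomputable section

open MeasureTheory
open scoped BigOperators ENNReal
open Literature.RepresentationTheory.FiniteGroups (TableauPair)

namespace Summit.MatrixMultiplication.MatrixMultiplication.Theorems

set_option linter.dupNamespace false

namespace PlancherelGrowth

/-- The discrete σ-algebra on the finite type of same-shape tableau pairs. [folklore] -/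
instance instMeasurableSpace (n : ℕ) : MeasurableSpace (TableauPair n) := ⊤

/-- Every set of tableau pairs is measurable (discrete σ-algebra). [folklore] -/
theorem measurableSet_top {n : ℕ} (s : Set (TableauPair n)) : MeasurableSet s := MeasurableSpace.measurableSet_top

/-- The discrete σ-algebra makes `TableauPair n` a measurable-singleton space. [folklore] -/
instance instMeasurableSingletonClass (n : ℕ) : MeasurableSingletonClass (TableauPair n) :=
  ⟨fun _ => MeasurableSpace.measurableSet_top⟩

/-- The uniform probability measure on same-shape tableau pairs of size `n`: `(n!)⁻¹ · counting measure`
(`Nat.card (TableauPair n) = n!`, tree `card_tableauPair`). [folklore] -/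
def pairMeasure (n : ℕ) : Measure (TableauPair n) := ((n.factorial : ℝ≥0∞)⁻¹) • Measure.count

/-- The prefix key at time `t`: the cell of each entry `< t` of the SECOND tableau, `none` for entries `≥ t`.  Two pairs have the same
key at time `t` iff their second tableaux agree on the entries `< t`. [folklore] -/
def prefixKey (n t : ℕ) (ω : TableauPair n) : Fin n → Option (ℕ × ℕ) :=
  fun k => if k.1 < t then some ((ω.2.2).1 k) else none

/-- The key at an earlier time is a function of the key at a later time. [folklore] -/
theorem prefixKey_of_le {n s t : ℕ} (hst : s ≤ t) (ω : TableauPair n) :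
    prefixKey n s ω = fun k => if k.1 < s then prefixKey n t ω k else none := by
  funext k
  unfold prefixKey
  by_cases hk : k.1 < s
  · rw [if_pos hk, if_pos hk, if_pos (lt_of_lt_of_le hk hst)]
  · rw [if_neg hk, if_neg hk]

/-- The PREFIX FILTRATION of the Plancherel growth: `ℱ_t` is generated by the cells of the entries `< t` of the second tableau. [folklore] -/
def prefixFiltration (n : ℕ) : Filtration ℕ (instMeasurableSpace n) where
  seq t := MeasurableSpace.comap (prefixKey n t) ⊤
  mono' s t hst := by
    have h : prefixKey n s = (fun g : Fin n → Option (ℕ × ℕ) => fun k => if k.1 < s then g k else none) ∘ prefixKey n t :=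
      funext fun ω => prefixKey_of_le hst ω
    show MeasurableSpace.comap (prefixKey n s) ⊤ ≤ MeasurableSpace.comap (prefixKey n t) ⊤
    rw [h, ← MeasurableSpace.comap_comp]
    exact MeasurableSpace.comap_mono le_top
  le' t := le_top

end PlancherelGrowth

/-- Anchor: the uniform measure has total mass one (`count univ = n!`). [folklore] -/
theorem pairMeasure_univ : ∀ n : ℕ, PlancherelGrowth.pairMeasure n Set.univ = 1 := by
  intro n
  classical
  have hfin : (Finset.univ : Finset (TableauPair n)).card = n.factorial := by
    rw [Finset.card_univ, ← Nat.card_eq_fintype_card]; exact card_tableauPair n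
  rw [PlancherelGrowth.pairMeasure, Measure.smul_apply, Measure.count_univ, smul_eq_mul,
    ENat.card_eq_coe_fintype_card]
  have : ((Fintype.card (TableauPair n) : ℕ∞) : ℝ≥0∞) = (n.factorial : ℝ≥0∞) := by
    rw [← Finset.card_univ, hfin]; rfl
  rw [this]
  exact ENNReal.inv_mul_cancel (by exact_mod_cast (Nat.factorial_pos n).ne') (ENNReal.natCast_ne_top _)

end Summit.MatrixMultiplication.MatrixMultiplication.Theorems

end
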